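import Literature.MathematicalPhysics.QuantumFieldTheory.Balaban1983to89.B14Claim283RAnalytic
import Literature.MathematicalPhysics.QuantumFieldTheory.Balaban1983to89.B14Eq348SecondClass

/-!
# `Balaban1983to89.B14.Eq356ExtensionFeed` — [Balaban1988Convergent] p. 281, the resummation of (3.56) over the
# first-class domains at `z`: «we extend the sum on the right-hand side to all domains X ∈ 𝐃_j … containing the point z.
# The difference between the two sums contributes to the irrelevant terms only, by the bounds (3.48)» — the SECOND-CLASS
# part of that difference AT CHART LEVEL: the main (marginal) term of (3.49) of a second-class domain, sized by the Cauchy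
# estimate of `…Claim283RAnalytic` at `S = E₀exp(−κd_j(X))` and the field pieces of (I.4.16)–(I.4.17)
# (`…Claim283RBound.main349_norm_le`), SUMMED over the second-class domains above the cube of `z` by (3.48) + (1.26)
# (`…B14.Eq348SecondClass.abs_secondClass_sum_le`) into the `(L^{j−n})^{5−b}`-shape of `…Thm2Assembly.PointDataE`,
# constant `C·E₀·K₀(c₀,Δ)·(5/κ)⁵e⁻⁵` EXPLICIT

HONEST FRAMING (cell `lit-balaban`, verbatim): statement-level skeleton of published theorems with citation tags;
proofs where landed; nothing here is a claim about the Yang–Mills mass gap.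

CITATION HEADER (lean-in-tree rule).  Source: T. Bałaban, *Convergent renormalization expansions for lattice gauge
theories*, Commun. Math. Phys. **119** (1988) 243–285, doi:10.1007/bf01217741 [Balaban1988Convergent] (cell paper
B14 = "[III]"; PDF held `paper:balaban1988-cmp119-convergent-renormalization`, journal page = PDF page + 242; text layer
p0038/p0039 re-read by the author of this file, 2026-08-22): (3.48)–(3.49) p. 280 [PDF 38], (3.56) and the resummation
paragraph p. 281 [PDF 39] tl.24–29, (2.27)(ii)/(iv) p. 259; [II] = T. Bałaban, Commun. Math. Phys. **116** (1988) 1–22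
[Balaban1988RG2Cluster], (1.26) p. 8; [I] = T. Bałaban, Commun. Math. Phys. **109** (1987) 249–301 [Balaban1987RG1],
(1.18) p. 263 (= «(I.1.18)» of [III] p. 259 (2.27)(iv); v1 mis-cited it as «[II] (1.18) p. 7» / «(II.1.18)», CITELOC
DELTA #11 of the cell `pub-balaban` summit-lit1 gen 44), (4.3)–(4.5) pp. 281–282, (4.16)–(4.17) p. 285.  Mega-formalization `lit-balaban` (HOME
`run/shared/lean/pub/lit-balaban/`), reader/typer unit `lit-balaban-r11` (generation 11, fold owner of B14), SKELETON rows
**B14.Eq3.55–3.57** (cell: the resummation of (3.56)), **B14.Eq3.48**, **B14.Eq3.67** / **B14.Thm2** (status cells).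
Imports the row's own `…B14Claim283RAnalytic` (gen 10) and `…B14Eq348SecondClass` (gen 5) and uses their theorems BY NAME;
modifies nothing; NO `def`, no new `Prop`, no named fact (D-0026: theorems only).

THE PRINTED TEXT (verbatim, p. 281 [PDF 39]).  *«The identities (3.56) hold for the localization domains X satisfying
the condition X ⊂ □̃^{∼2}. We sum up the identities over all such domains, and we extend the sum on the right-hand side
to all domains X ∈ 𝐃_j for the space L⁻ʲZ^d, X containing the point z. The difference between the two sums contributes
to the irrelevant terms only, by the bounds (3.48). Thus we obtain the identity (3.56) resummed over the domains X, but
with the first expression on the right-hand side replaced by ½ Σ Π^{(j)}_{μν,κλ} tr F_{κμ}(z)F_{λν}(z). (3.57)»*; (3.48)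
p. 280: *«|𝐄^{(j)}(X, z)| ≤ E₀ exp(−κ(LʲL⁻ⁿ)⁻¹) exp(−½κd_j(X))»* for the second-class domains, *«and the sum over X is
bounded by O(1)exp(−κ(LʲL⁻ⁿ)⁻¹) ≤ O(1)(LʲL⁻ⁿ)⁵»*; p. 281 tl.22–24: *«(the irrelevant terms) … denotes the sum of terms
which can be bounded by O((LʲL⁻ⁿ)^{5−β}) exp(−κd_j(X)), where β is a positive number»*.

WHAT THIS FILE PROVES (theorems only).  §1 `mainTerm_le_of_chart`: for a functional whose chart `B ↦ ℰ(exp ρB)` is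
complex-analytic on `‖B‖ < α` and bounded there by `E₀exp(−κd_j(X))` ((2.27)(ii) + (iv)), the MAIN (marginal) term of
(3.49) `½D²f(0)(w, w)`, `w = ℓ + ½ i[λ_z, B(z)]`, with the pieces `‖B(z)‖, ‖λ_z‖ ≤ aσ`, `‖B(·, z)‖ ≤ aσ²` of (I.4.16)–(I.4.17),
dominates any real `m` with `|m| ≤ ‖½D²f(0)(w, w)‖` by `|m| ≤ C·σ⁴·E₀·exp(−κd_j(X))` for every
`C ≥ ½(4/α)²(a + ½ba²)²` — `…Claim283RBound.main349_norm_le` with the second-derivative size from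
`…Claim283RAnalytic.norm_fderiv₂_real_le` ([I] (4.3)–(4.5)).  §2 **`extensionDiff_secondClass_le`**: at ONE point `z` of
scale `n ≥ j` (`s = L^{j−n} ∈ (0, 1]`) with its cube `□_z`, for an abstract second-class predicate with the printed
geometry `X ∋ □_z, X second class ⇒ d_j(X) ≥ 2s⁻¹` (row B14.Eq3.48; proved for the cell's cube systems in
`…B14.Eq348ClassGeometry`), ONE functional `ℰ_X` per second-class domain above `□_z` with the chart hypotheses of §1 and
ONE set of field pieces `λ_z, c = ∂λ_z, ℓ` at `σ = s`: the sum of the main terms over the second-class domains above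
`□_z` — the second-class part of «the difference between the two sums» — obeys
`|Σ m(X)| ≤ (C·E₀·K₀(c₀, Δ)·(5/κ)⁵e⁻⁵)·(L^{j−n})^{5−β}` for every `β ≥ 0` and `κ/2 ≥ κ₀(c₀, Δ)` — `…Eq348SecondClass.abs_
secondClass_sum_le` applied to the main terms extended by zero (the `(L^{j−n})^{5−b}`-shape of `PointDataE`'s
irrelevant inputs; in fact `O((LʲL⁻ⁿ)⁹)`, the surplus `σ⁴ ≤ 1` dropped).

HONEST SCOPE.  (1) Print extends the sum to «all domains X ∈ 𝐃_j for the space L⁻ʲZ^d»; this file bounds the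
contribution of the SECOND-CLASS domains of the SAME cube system above `□_z` (the torus-side part of the difference);
the passage from the torus's domains to the domains of the infinite lattice `L⁻ʲZ^d` (needed for the symmetries
(3.58)–(3.60), cf. `…B14Eq364Symmetries`/(3.62) «on the infinite lattice», gen 8) is NOT here.  (2) The main term is
taken in its (3.49) form `½⟨𝐄^{(2)}, w, w⟩`; print performs the extension at the (3.56) stage (after the
antisymmetrization (3.55)) — the same bilinear power counting, recorded.  (3) As in the imported files the chart
hypotheses ((ii) + (iv) on a ball of Lie-algebra fields of radius `α`, pieces `a` of (I.4.16)–(I.4.17), bracket bound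
`b`) are letters; `E₀, κ` are the constants of (2.27)(iv) = (I.1.18); Bałaban's concrete 𝐄^{(j)}(X, ·, z) is not
instantiated on one carrier (row head policy G.5-45 unchanged); nothing about the Yang–Mills mass gap.

## References
* [Balaban1988Convergent] T. Bałaban, Commun. Math. Phys. 119 (1988) 243–285: (3.48)–(3.49) p.280, (3.56)–(3.57) p.281.
* [Balaban1988RG2Cluster] T. Bałaban, Commun. Math. Phys. 116 (1988) 1–22 ([II]: (1.26) p.8).
* [Balaban1987RG1] T. Bałaban, Commun. Math. Phys. 109 (1987) 249–301 ([I]: (1.18) p.263, (4.3)–(4.5) pp.281–282, (4.16)–(4.17)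
  p.285).
-/

open Set Metric Filter
open scoped Topology BigOperators

namespace Literature.MathematicalPhysics.QuantumFieldTheory.Balaban1983to89.B14.Eq356ExtensionFeed

open Literature.MathematicalPhysics.QuantumFieldTheory.Balaban1983to89
open Literature.MathematicalPhysics.QuantumFieldTheory.Balaban1983to89.B12TreeDecay

section Chart

open NormedSpace (exp)

variable {𝔄 : Type*} [NormedRing 𝔄] [NormedAlgebra ℝ 𝔄] {Λ T : Type*} [Fintype Λ] [Fintype T]
  {V : Type*} [NormedAddCommGroup V] [NormedSpace ℂ V] {F : Type*} [NormedAddCommGroup F]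
  [NormedSpace ℂ F] [CompleteSpace F]

/-! ## §1. The main term of (3.49) of one domain, sized by (2.27)(iv) and the Cauchy estimate -/

-- (the nested operator space over the iterated `Pi` type: one more level of pending instance synthesis)
set_option maxSynthPendingDepth 3 in
/-- **The main (marginal) term of (3.49) of one domain, per (2.27)(iv)**: in the chart `f(B) = ℰ(exp ρB)` of a functional
complex-analytic on `‖B‖ < α` and bounded there by `E₀exp(−κd_j(X))`, with `‖B(z)‖, ‖λ_z‖ ≤ aσ`, `‖B(·, z)‖ ≤ aσ²`
((I.4.16)–(I.4.17), `σ = LʲL⁻ⁿ`), any real `m` dominated by `‖½D²f(0)(w, w)‖`, `w = B(·, z) + ½ i[λ_z, B(z)]`, obeys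
`|m| ≤ C·σ⁴·E₀·exp(−κd_j(X))` for every `C ≥ ½(4/α)²(a + ½ba²)²` — `…Claim283RBound.main349_norm_le` with the size
`‖D²f(0)(u, v)‖ ≤ E₀e^{−κd_j(X)}(4/α)²‖u‖‖v‖` of `…Claim283RAnalytic.norm_fderiv₂_real_le`; for a second-class domain this is
the quantity print bounds «by the bounds (3.48)». [cite: Balaban1988Convergent, (3.49) p.280, p.281, (2.27) p.259;
Balaban1987RG1, (4.3)–(4.5) pp.281–282, (4.16)–(4.17) p.285] -/
theorem mainTerm_le_of_chart {𝔤 : Type*} [LieRing 𝔤] [LieAlgebra ℝ 𝔤] (eV : V ≃ₗ[ℝ] 𝔤)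
    {ℰ : (Λ → T → 𝔄) → F} (ρ : V →L[ℝ] 𝔄) {α : ℝ} (hα : 0 < α) {E₀ κ dX : ℝ} (hE₀ : 0 ≤ E₀)
    (hf : AnalyticOnNhd ℂ (fun A : Λ → T → V => ℰ (fun ν y => exp (ρ (A ν y)))) (ball 0 α))
    (hS : ∀ A ∈ ball (0 : Λ → T → V) α, ‖ℰ (fun ν y => exp (ρ (A ν y)))‖ ≤ E₀ * Real.exp (-κ * dX))
    {b : ℝ} (hb0 : 0 ≤ b) (hb : ∀ x y : V, ‖eV.symm ⁅eV x, eV y⁆‖ ≤ b * ‖x‖ * ‖y‖)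
    (lam : T → V) (c ℓ : Λ → T → V) {a σ : ℝ} (ha : 0 ≤ a) (hσ0 : 0 ≤ σ) (hcn : ‖c‖ ≤ a * σ)
    (hlam : ‖lam‖ ≤ a * σ) (hℓ : ‖ℓ‖ ≤ a * σ ^ 2) {C : ℝ}
    (hC : (2 : ℝ)⁻¹ * (4 / α) ^ 2 * (a + (2 : ℝ)⁻¹ * b * a ^ 2) ^ 2 ≤ C) {m : ℝ}
    (hm : |m| ≤ ‖(2 : ℝ)⁻¹ • fderiv ℝ (fderiv ℝ (fun A : Λ → T → V => ℰ (fun ν y => exp (ρ (A ν y))))) 0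
        (ℓ + (2 : ℝ)⁻¹ • fun ν y => eV.symm ⁅eV (lam y), eV (c ν y)⁆)
        (ℓ + (2 : ℝ)⁻¹ • fun ν y => eV.symm ⁅eV (lam y), eV (c ν y)⁆)‖) :
    |m| ≤ C * σ ^ 4 * E₀ * Real.exp (-κ * dX) := by
  have hS0 : 0 ≤ E₀ * Real.exp (-κ * dX) := mul_nonneg hE₀ (Real.exp_nonneg _)
  have key := Claim283RBound.main349_norm_le
    (fderiv ℝ (fderiv ℝ (fun A : Λ → T → V => ℰ (fun ν y => exp (ρ (A ν y))))) 0)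
    (show 0 ≤ E₀ * Real.exp (-κ * dX) * (4 / α) ^ 2 by positivity)
    (fun u v => Claim283RAnalytic.norm_fderiv₂_real_le hα hf hS u v)
    (LinearMap.mk₂ ℝ (fun a b => eV.symm ⁅eV a, eV b⁆) (fun _ _ _ => by simp) (fun _ _ _ => by simp)
      (fun _ _ _ => by simp) (fun _ _ _ => by simp)) hb0 (fun x y => by simpa only [LinearMap.mk₂_apply] using hb x y)
    lam c ℓ ha hσ0 hcn hlam hℓ
  simp only [LinearMap.mk₂_apply] at key
  have hw : 0 ≤ σ ^ 4 * E₀ * Real.exp (-κ * dX) := mul_nonneg (mul_nonneg (pow_nonneg hσ0 4) hE₀) (Real.exp_nonneg _)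
  have hCw := mul_le_mul_of_nonneg_right hC hw
  refine hm.trans (key.trans ?_)
  linarith [hCw]

/-! ## §2. The second-class part of «the difference between the two sums», per point, in `PointDataE`'s shape -/

/-- `(4:ℕ)`-th power of a number in `[0, 1]` is at most `1`. [folklore] -/
private theorem pow_four_le_one {σ : ℝ} (hσ0 : 0 ≤ σ) (hσ1 : σ ≤ 1) : σ ^ 4 ≤ 1 := pow_le_one₀ hσ0 hσ1

-- (the nested operator space over the iterated `Pi` type: one more level of pending instance synthesis)
set_option maxSynthPendingDepth 3 in
/-- **p. 281, the second-class part of the extension difference at the point `z`**: ONE point `z` of scale `n ≥ j`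
(`s = L^{j−n}`, `L ≥ 1`) with its cube `□_z` in a cube system of degree `≤ Δ` and volume leaf `c₀`, `κ/2 ≥ κ₀(c₀, Δ)`,
`κ > 0`; an abstract second-class predicate with the printed geometry «X ∋ □_z second class ⇒ d_j(X) ≥ 2s⁻¹» (row
B14.Eq3.48, `…B14.Eq348ClassGeometry`); ONE functional `ℰ_X` per second-class domain above `□_z` whose chart is
complex-analytic on `‖B‖ < α` and bounded there by `E₀exp(−κd_j(X))` ((2.27)(ii) + (iv)); ONE set of field pieces
`λ_z, c, ℓ` at `σ = s` ((I.4.16)–(I.4.17)); real main terms `|m(X)| ≤ ‖½D²f_X(0)(w, w)‖`.  Then the sum of the main terms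
over the second-class domains above `□_z` obeys `|Σ m(X)| ≤ (C·E₀·K₀(c₀,Δ)·(5/κ)⁵e⁻⁵)·(L^{j−n})^{5−β}` for every `β ≥ 0`
— «contributes to the irrelevant terms only, by the bounds (3.48)», in the `(L^{j−n})^{5−b}`-shape of
`…Thm2Assembly.PointDataE` (`…Eq348SecondClass.abs_secondClass_sum_le` on the main terms extended by zero, the surplus
`σ⁴ ≤ 1` dropped). [cite: Balaban1988Convergent, p.281, (3.48) p.280, (3.56)–(3.57) p.281; Balaban1988RG2Cluster,
(1.26) p.8; Balaban1987RG1, (1.18) p.263, (4.16)–(4.17) p.285] -/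
theorem extensionDiff_secondClass_le
    {Sy : LocDomainSys} (G : CubeSystem Sy) {Δ : ℕ} (hΔ : G.DegreeLE Δ) {c₀ : ℝ} (hV : G.VolumeLeaf c₀) {κ : ℝ}
    (hκ : kappa₀ c₀ Δ ≤ κ / 2) (hκ0 : 0 < κ)
    {𝔤 : Type*} [LieRing 𝔤] [LieAlgebra ℝ 𝔤] (eV : V ≃ₗ[ℝ] 𝔤) (ρ : V →L[ℝ] 𝔄) {α : ℝ} (hα : 0 < α) {E₀ : ℝ}
    (hE₀ : 0 ≤ E₀) {b : ℝ} (hb0 : 0 ≤ b) (hb : ∀ x y : V, ‖eV.symm ⁅eV x, eV y⁆‖ ≤ b * ‖x‖ * ‖y‖)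
    {a : ℝ} (ha : 0 ≤ a) {C : ℝ} (hC : (2 : ℝ)⁻¹ * (4 / α) ^ 2 * (a + (2 : ℝ)⁻¹ * b * a ^ 2) ^ 2 ≤ C)
    {L : ℝ} (hL : 1 ≤ L) {j n : ℕ} (hjn : j ≤ n) {β : ℝ} (hβ0 : 0 ≤ β)
    (cz : G.Cube) (second : Sy.Dom → Prop) [DecidablePred second]
    (hclass : ∀ X ∈ G.above cz, second X → 2 * (L ^ ((j : ℝ) - n))⁻¹ ≤ Sy.dj X)
    (ℰ : Sy.Dom → (Λ → T → 𝔄) → F)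
    (hf : ∀ X ∈ (G.above cz).filter second,
      AnalyticOnNhd ℂ (fun A' : Λ → T → V => ℰ X (fun ν y => exp (ρ (A' ν y)))) (ball 0 α))
    (hS : ∀ X ∈ (G.above cz).filter second, ∀ A' ∈ ball (0 : Λ → T → V) α,
      ‖ℰ X (fun ν y => exp (ρ (A' ν y)))‖ ≤ E₀ * Real.exp (-κ * Sy.dj X))
    (lam : T → V) (c ℓ : Λ → T → V) (hcn : ‖c‖ ≤ a * L ^ ((j : ℝ) - n)) (hlam : ‖lam‖ ≤ a * L ^ ((j : ℝ) - n))
    (hℓ : ‖ℓ‖ ≤ a * (L ^ ((j : ℝ) - n)) ^ 2)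
    (m : Sy.Dom → ℝ)
    (hm : ∀ X ∈ (G.above cz).filter second, |m X| ≤
      ‖(2 : ℝ)⁻¹ • fderiv ℝ (fderiv ℝ (fun A' : Λ → T → V => ℰ X (fun ν y => exp (ρ (A' ν y))))) 0
        (ℓ + (2 : ℝ)⁻¹ • fun ν y => eV.symm ⁅eV (lam y), eV (c ν y)⁆)
        (ℓ + (2 : ℝ)⁻¹ • fun ν y => eV.symm ⁅eV (lam y), eV (c ν y)⁆)‖) :
    |∑ X ∈ (G.above cz).filter second, m X|
      ≤ (C * E₀ * K₀ c₀ Δ * (((5 : ℝ) / κ) ^ 5 * Real.exp (-(5 : ℝ)))) * (L ^ ((j : ℝ) - n)) ^ ((5 : ℝ) - β) := by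
  classical
  set s : ℝ := L ^ ((j : ℝ) - n) with hs_def
  have hL0 : 0 < L := lt_of_lt_of_le one_pos hL
  have hs0 : 0 < s := Real.rpow_pos_of_pos hL0 _
  have hs1 : s ≤ 1 := by
    apply Real.rpow_le_one_of_one_le_of_nonpos hL
    have : (j : ℝ) ≤ n := by exact_mod_cast hjn
    linarith
  have hC0 : 0 ≤ C := le_trans (by positivity) hC
  -- the main terms extended by zero outside the second-class family above `□_z`
  set E' : Sy.Dom → ℝ := fun X => if X ∈ (G.above cz).filter second then m X else 0 with hE'_def
  have h118 : ∀ X, |E' X| ≤ C * s ^ 4 * E₀ * Real.exp (-κ * Sy.dj X) := by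
    intro X
    by_cases hX : X ∈ (G.above cz).filter second
    · have e : E' X = m X := by rw [hE'_def]; exact if_pos hX
      rw [e]
      exact mainTerm_le_of_chart eV ρ hα hE₀ (hf X hX) (hS X hX) hb0 hb lam c ℓ ha hs0.le hcn hlam hℓ hC (hm X hX)
    · have e : E' X = 0 := by rw [hE'_def]; exact if_neg hX
      rw [e, abs_zero]
      exact mul_nonneg (mul_nonneg (mul_nonneg hC0 (pow_nonneg hs0.le 4)) hE₀) (Real.exp_nonneg _)
  have hsum : ∑ X ∈ (G.above cz).filter second, E' X = ∑ X ∈ (G.above cz).filter second, m X :=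
    Finset.sum_congr rfl fun X hX => by rw [hE'_def]; exact if_pos hX
  have key := Eq348SecondClass.abs_secondClass_sum_le G hΔ hV
    (show 0 ≤ C * s ^ 4 * E₀ from mul_nonneg (mul_nonneg hC0 (pow_nonneg hs0.le 4)) hE₀) hκ hκ0 hs0 hs1 hβ0 h118
    cz second hclass
  rw [hsum] at key
  have hP : 0 ≤ C * E₀ * K₀ c₀ Δ * (((5 : ℝ) / κ) ^ 5 * Real.exp (-(5 : ℝ))) * s ^ ((5 : ℝ) - β) :=
    mul_nonneg (mul_nonneg (mul_nonneg (mul_nonneg hC0 hE₀) (K₀_pos c₀ Δ).le)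
      (mul_nonneg (pow_nonneg (div_nonneg (by norm_num) hκ0.le) 5) (Real.exp_nonneg _))) (Real.rpow_nonneg hs0.le _)
  calc |∑ X ∈ (G.above cz).filter second, m X|
      ≤ C * s ^ 4 * E₀ * K₀ c₀ Δ * (((5 : ℝ) / κ) ^ 5 * Real.exp (-(5 : ℝ))) * s ^ ((5 : ℝ) - β) := key
    _ = s ^ 4 * (C * E₀ * K₀ c₀ Δ * (((5 : ℝ) / κ) ^ 5 * Real.exp (-(5 : ℝ))) * s ^ ((5 : ℝ) - β)) := by ring
    _ ≤ 1 * (C * E₀ * K₀ c₀ Δ * (((5 : ℝ) / κ) ^ 5 * Real.exp (-(5 : ℝ))) * s ^ ((5 : ℝ) - β)) :=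
        mul_le_mul_of_nonneg_right (pow_four_le_one hs0.le hs1) hP
    _ = (C * E₀ * K₀ c₀ Δ * (((5 : ℝ) / κ) ^ 5 * Real.exp (-(5 : ℝ)))) * s ^ ((5 : ℝ) - β) := by
        rw [one_mul]

end Chart

end Literature.MathematicalPhysics.QuantumFieldTheory.Balaban1983to89.B14.Eq356ExtensionFeed
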